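import Literature.Analysis.FluidPDE.ConfinedHardSphereFlowConstruction
import Literature.Analysis.FluidPDE.HardSphereFlowOrbits
import HarnessLib

/-!
# Events of the confined hard-sphere dynamics among round scatterers: kinematics and exit times

Second layer of the proof of `ConfinedHardSphereFlow.nonempty_torus_balls` (existence of the
confined hard-sphere flow on the torus among fixed round scatterers; Cercignani–Illner–Pulvirenti
1994 Thm. 4.2.1 with App. 4.A p. 111), for the event-by-event construction
`ConfinedAlexander.flow` of `Literature.Analysis.FluidPDE.ConfinedHardSphereFlowConstruction`.
It is the analogue, for the second kind of event (a sphere reflecting specularly at a fixed round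
scatterer), of the near-contact analysis of `HardSphereRegularGeometry` and of the exit-time /
simple-collision part of `HardSphereFlowOrbits`:

* `Wall.balls G ctr ρ hρ` — the family of round scatterers (`Wall.ball`) of common exclusion
  radius `ρ` centred at `ctr : ι → X`, with the unfolding lemmas of contact / region /
  incoming / outgoing in terms of the separation vector `G.sepVec xᵢ (ctr k)`;
* kinematics of one sphere near one scatterer in a geometry regular at `ρ`
  (`Geometry.IsHardSphereRegular G ρ`): the distance to the centre along free flight is locally
  the quadratic `|n|² + 2t⟪n, v⟫ + t²|v|²`, so a wall-outgoing contact separates, a wall-incoming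
  one penetrates (forward) and was separated (backward), a non-incoming one does not penetrate —
  the one-particle copies of the pair lemmas (the scatterer is a partner at rest);
* closedness of the confined domain, and the two facts the construction needs: with no incoming
  contact of either kind the free flight stays confined for a while
  (`eventually_freeFlight_mem_confinedDomain`), an incoming wall contact exits at once;
* exit times: `exitTime_eq_zero_of_isIncoming`, `exitTime_eq_zero_of_isWallIncoming`,
  `exitTime_pos`, `freeFlight_exitTime_mem` (the exit configuration is confined),
  `exists_event_freeFlight_exitTime` (it carries an incoming pair contact or an incoming wall
  contact);
* simple events with the event named: `IsSimplePairEventWith`, `IsSimpleWallEventWith`, their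
  API (`eventJump` is then `collidePair`, resp. `reflectWall`, no choice being made; after the
  event every contact is outgoing and the exit time is positive), and `eventStep` at a simple
  exit configuration.

## Mathlib / Literature reuse

`Alexander.IsSimpleIncomingWith` and its API (`incomingPairs_eq`, `isOutgoing_collidePair`,
`collidePair_eq`, `of_fst_eq`, …) are `HardSphereFlowOrbits`'; the pair kinematics
(`eventually_*_norm_sepVec_freeFlight_*`, `eventually_freeFlight_mem`) are
`HardSphereRegularGeometry`'s. Mathlib has no billiard dynamics.

## References

* C. Cercignani, R. Illner, M. Pulvirenti, *The Mathematical Theory of Dilute Gases*, Springer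
  (1994), §4.2 pp. 64–65 ((2.2), Thm. 4.2.1), App. 4.A pp. 107–111.
* R. K. Alexander, *The infinite hard sphere system*, PhD thesis, UC Berkeley (1975).
-/

open Set Filter Function
open scoped ENNReal Topology InnerProductSpace

namespace Literature.Analysis.FluidPDE

noncomputable section

section Kinetic

variable {d : Type*} [Fintype d] {X : Type*} {N : ℕ} {ι : Type*}

/-! ## Round scatterers of a common radius -/

/-- The family of ROUND SCATTERERS of common exclusion radius `ρ > 0` for the sphere centres,
centred at the points `ctr k`, `k : ι`, in the geometry `G` (each is `Wall.ball G (ctr k) ρ`: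
region `ρ ≤ |x - ctr k|`, contact `|x - ctr k| = ρ`, inner normal `(x - ctr k)/ρ`; the periodic
Lorentz array / Sinai billiard environment of `ConfinedHardSphereFlow.nonempty_torus_balls`).
[cite: CIP1994, §4.2 p. 64] -/
def Wall.balls (G : Geometry d X) (ctr : ι → X) (ρ : ℝ) (hρ : 0 < ρ) : ι → Wall d X :=
  fun k => Wall.ball G (ctr k) ρ hρ

namespace Wall

variable {G : Geometry d X} {ctr : ι → X} {ρ : ℝ} {hρ : 0 < ρ}

/-- Unfolding lemma for `Wall.balls`. [folklore] -/
@[simp]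
theorem balls_apply (G : Geometry d X) (ctr : ι → X) (ρ : ℝ) (hρ : 0 < ρ) (k : ι) :
    balls G ctr ρ hρ k = ball G (ctr k) ρ hρ := rfl

/-- Contact with the `k`-th scatterer: `|x - ctr k| = ρ`. [folklore] -/
theorem mem_balls_contact_iff {k : ι} {x : X} :
    x ∈ (balls G ctr ρ hρ k).contact ↔ ‖G.sepVec x (ctr k)‖ = ρ := Iff.rfl

/-- Admissibility for the `k`-th scatterer: `ρ ≤ |x - ctr k|`. [folklore] -/
theorem mem_balls_region_iff {k : ι} {x : X} :
    x ∈ (balls G ctr ρ hρ k).region ↔ ρ ≤ ‖G.sepVec x (ctr k)‖ := Iff.rfl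

/-- Wall-incoming for a round scatterer: `⟪xᵢ - ctr k, vᵢ⟫ < 0` (the sphere approaches the
centre). [folklore] -/
theorem isWallIncoming_balls_iff {k : ι} {z : Config N d X} {i : Fin N} :
    IsWallIncoming (balls G ctr ρ hρ k) z i ↔ ⟪G.sepVec (z i).1 (ctr k), (z i).2⟫_ℝ < 0 := by
  rw [IsWallIncoming, balls_apply, ball_normal, real_inner_smul_right, real_inner_comm]
  constructor
  · intro h
    by_contra h'
    exact (not_le.2 h) (mul_nonneg (inv_pos.2 hρ).le (not_lt.1 h'))
  · exact fun h => mul_neg_of_pos_of_neg (inv_pos.2 hρ) h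

/-- Wall-outgoing for a round scatterer: `0 < ⟪xᵢ - ctr k, vᵢ⟫`. [folklore] -/
theorem isWallOutgoing_balls_iff {k : ι} {z : Config N d X} {i : Fin N} :
    IsWallOutgoing (balls G ctr ρ hρ k) z i ↔ 0 < ⟪G.sepVec (z i).1 (ctr k), (z i).2⟫_ℝ := by
  rw [IsWallOutgoing, balls_apply, ball_normal, real_inner_smul_right, real_inner_comm]
  constructor
  · intro h
    by_contra h'
    exact (not_le.2 h) (mul_nonpos_of_nonneg_of_nonpos (inv_pos.2 hρ).le (not_lt.1 h'))
  · exact fun h => mul_pos (inv_pos.2 hρ) h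

end Wall

/-- Membership in the confined domain among round scatterers. [folklore] -/
theorem mem_confinedDomain_balls_iff {G : Geometry d X} {ctr : ι → X} {ρ : ℝ} {hρ : 0 < ρ} {ε : ℝ}
    {z : Config N d X} :
    z ∈ confinedDomain G (Wall.balls G ctr ρ hρ) N ε ↔
      z ∈ hardSphereDomain G N ε ∧ ∀ (i : Fin N) (k : ι), ρ ≤ ‖G.sepVec (z i).1 (ctr k)‖ :=
  Iff.rfl

/-! ## One sphere near one round scatterer under free flight -/

namespace Geometry.IsHardSphereRegular

variable [TopologicalSpace X] {G : Geometry d X} {ρ : ℝ}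

/-- The distance of sphere `i` to a fixed point is a continuous function of the configuration. [folklore] -/
theorem continuous_norm_sepVec_config_point (hG : G.IsHardSphereRegular ρ) (i : Fin N) (a : X) :
    Continuous fun z : Config N d X => ‖G.sepVec (z i).1 a‖ := by
  have h2 : Continuous fun z : Config N d X => ((z i).1, a) := by fun_prop
  simpa only [Function.comp_def] using hG.continuous_norm_sepVec.comp h2

/-- Local linearity of the separation from a fixed point along free flight: near a configuration
where sphere `i` is at distance `≤ ρ` from `a`, `x_i(t) - a = n + t v_i` for small `|t|`. [folklore] -/
theorem eventually_sepVec_freeFlight_point (hG : G.IsHardSphereRegular ρ) {z : Config N d X}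
    {i : Fin N} {a : X} (h : ‖G.sepVec (z i).1 a‖ ≤ ρ) :
    ∀ᶠ t : ℝ in 𝓝 0, G.sepVec (freeFlight G t z i).1 a = G.sepVec (z i).1 a + t • (z i).2 := by
  obtain ⟨δ, hδ, hlin⟩ := hG.exists_sepVec_translate
  have hsmall : ∀ᶠ t : ℝ in 𝓝 0, ‖t • (z i).2‖ < δ := by
    have hc : Continuous fun t : ℝ => ‖t • (z i).2‖ := (continuous_id.smul continuous_const).norm
    have ht := hc.tendsto 0
    simp only [zero_smul, norm_zero] at ht
    exact ht.eventually (gt_mem_nhds hδ)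
  filter_upwards [hsmall] with t ht
  have h0 : ‖(0 : EuclideanSpace ℝ d)‖ < δ := by simpa using hδ
  have := hlin (z i).1 a (t • (z i).2) 0 h ht h0
  rw [G.translate_zero, sub_zero] at this
  rw [freeFlight_apply, this]

/-- The distance to a fixed point along free flight is locally an explicit quadratic:
`|x_i(t) - a|² = |n|² + 2t ⟪n, v_i⟫ + t² |v_i|²` for small `|t|`. [folklore] -/
theorem eventually_norm_sq_sepVec_freeFlight_point (hG : G.IsHardSphereRegular ρ)
    {z : Config N d X} {i : Fin N} {a : X} (h : ‖G.sepVec (z i).1 a‖ ≤ ρ) :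
    ∀ᶠ t : ℝ in 𝓝 0, ‖G.sepVec (freeFlight G t z i).1 a‖ ^ 2 =
      ‖G.sepVec (z i).1 a‖ ^ 2 + 2 * t * ⟪G.sepVec (z i).1 a, (z i).2⟫_ℝ + t ^ 2 * ‖(z i).2‖ ^ 2 := by
  filter_upwards [hG.eventually_sepVec_freeFlight_point h] with t ht
  rw [ht, norm_add_sq_real, norm_smul, inner_smul_right, Real.norm_eq_abs, mul_pow, sq_abs]
  ring

/-- A sphere in non-incoming contact with a scatterer does not penetrate it for small nonnegative
times: `ρ ≤ |x_i(t) - a|` eventually in `t → 0⁺`. [folklore] -/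
theorem eventually_le_norm_sepVec_freeFlight_point_of_nonneg_inner (hG : G.IsHardSphereRegular ρ)
    {z : Config N d X} {i : Fin N} {a : X} (hc : ‖G.sepVec (z i).1 a‖ = ρ)
    (hin : 0 ≤ ⟪G.sepVec (z i).1 a, (z i).2⟫_ℝ) :
    ∀ᶠ t : ℝ in 𝓝[≥] 0, ρ ≤ ‖G.sepVec (freeFlight G t z i).1 a‖ := by
  have hρ : 0 ≤ ρ := hc ▸ norm_nonneg _
  have h := hG.eventually_norm_sq_sepVec_freeFlight_point hc.le
  rw [hc] at h
  filter_upwards [mem_nhdsWithin_of_mem_nhds h, self_mem_nhdsWithin] with t ht (ht0 : 0 ≤ t)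
  refine (sq_le_sq₀ hρ (norm_nonneg _)).1 ?_
  rw [ht]
  nlinarith [sq_nonneg t, sq_nonneg ‖(z i).2‖, mul_nonneg ht0 hin]

/-- A sphere in wall-outgoing contact with a scatterer separates strictly for small positive
times: `ρ < |x_i(t) - a|` eventually in `t → 0⁺`, `t > 0`. [folklore] -/
theorem eventually_lt_norm_sepVec_freeFlight_point_of_pos_inner (hG : G.IsHardSphereRegular ρ)
    {z : Config N d X} {i : Fin N} {a : X} (hc : ‖G.sepVec (z i).1 a‖ = ρ)
    (hout : 0 < ⟪G.sepVec (z i).1 a, (z i).2⟫_ℝ) :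
    ∀ᶠ t : ℝ in 𝓝[>] 0, ρ < ‖G.sepVec (freeFlight G t z i).1 a‖ := by
  have hρ : 0 ≤ ρ := hc ▸ norm_nonneg _
  have h := hG.eventually_norm_sq_sepVec_freeFlight_point hc.le
  rw [hc] at h
  filter_upwards [mem_nhdsWithin_of_mem_nhds h, self_mem_nhdsWithin] with t ht (ht0 : 0 < t)
  refine (sq_lt_sq₀ hρ (norm_nonneg _)).1 ?_
  rw [ht]
  nlinarith [sq_nonneg t, sq_nonneg ‖(z i).2‖, mul_pos ht0 hout]

/-- A sphere in wall-incoming contact with a scatterer penetrates it for small positive times: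
`|x_i(t) - a| < ρ` eventually in `t → 0⁺`, `t > 0` (so the reflection law must be applied). [folklore] -/
theorem eventually_norm_sepVec_freeFlight_point_lt_of_neg_inner (hG : G.IsHardSphereRegular ρ)
    {z : Config N d X} {i : Fin N} {a : X} (hc : ‖G.sepVec (z i).1 a‖ = ρ)
    (hin : ⟪G.sepVec (z i).1 a, (z i).2⟫_ℝ < 0) :
    ∀ᶠ t : ℝ in 𝓝[>] 0, ‖G.sepVec (freeFlight G t z i).1 a‖ < ρ := by
  have hρ : 0 ≤ ρ := hc ▸ norm_nonneg _
  set A : ℝ := ⟪G.sepVec (z i).1 a, (z i).2⟫_ℝ with hA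
  set B : ℝ := ‖(z i).2‖ ^ 2 with hB
  have hlin : ∀ᶠ t : ℝ in 𝓝 0, 2 * A + t * B < 0 := by
    have hc' : Continuous fun t : ℝ => 2 * A + t * B := by fun_prop
    have := hc'.tendsto 0
    simp only [zero_mul, add_zero] at this
    exact this.eventually (gt_mem_nhds (show 2 * A < 0 by linarith))
  have h := hG.eventually_norm_sq_sepVec_freeFlight_point hc.le
  rw [hc] at h
  filter_upwards [mem_nhdsWithin_of_mem_nhds h, mem_nhdsWithin_of_mem_nhds hlin,
    self_mem_nhdsWithin] with t ht hlt (ht0 : 0 < t)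
  refine (sq_lt_sq₀ (norm_nonneg _) hρ).1 ?_
  rw [ht]
  nlinarith [mul_neg_of_pos_of_neg ht0 hlt]

/-- A sphere in wall-incoming contact with a scatterer was strictly separated at small negative
times. [folklore] -/
theorem eventually_lt_norm_sepVec_freeFlight_point_of_neg_inner (hG : G.IsHardSphereRegular ρ)
    {z : Config N d X} {i : Fin N} {a : X} (hc : ‖G.sepVec (z i).1 a‖ = ρ)
    (hin : ⟪G.sepVec (z i).1 a, (z i).2⟫_ℝ < 0) :
    ∀ᶠ t : ℝ in 𝓝[<] 0, ρ < ‖G.sepVec (freeFlight G t z i).1 a‖ := by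
  have hρ : 0 ≤ ρ := hc ▸ norm_nonneg _
  have h := hG.eventually_norm_sq_sepVec_freeFlight_point hc.le
  rw [hc] at h
  filter_upwards [mem_nhdsWithin_of_mem_nhds h, self_mem_nhdsWithin] with t ht (ht0 : t < 0)
  refine (sq_lt_sq₀ hρ (norm_nonneg _)).1 ?_
  rw [ht]
  nlinarith [sq_nonneg t, sq_nonneg ‖(z i).2‖, mul_pos_of_neg_of_neg ht0 hin]

/-- A sphere strictly away from a scatterer (`ρ < |x_i - a|`) stays away for small times. [folklore] -/
theorem eventually_lt_norm_sepVec_freeFlight_point_of_lt (hG : G.IsHardSphereRegular ρ)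
    {z : Config N d X} {i : Fin N} {a : X} (h : ρ < ‖G.sepVec (z i).1 a‖) :
    ∀ᶠ t : ℝ in 𝓝 0, ρ < ‖G.sepVec (freeFlight G t z i).1 a‖ := by
  have hc : Continuous fun t : ℝ => ‖G.sepVec (freeFlight G t z i).1 a‖ := by
    simpa only [Function.comp_def] using
      (hG.continuous_norm_sepVec_config_point i a).comp (hG.continuous_freeFlight z)
  have ht := hc.tendsto 0
  simp only [freeFlight_zero] at ht
  exact ht.eventually (lt_mem_nhds h)

end Geometry.IsHardSphereRegular

/-! ## The confined domain among round scatterers in a regular geometry -/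

namespace ConfinedAlexander

variable {G : Geometry d X} {ctr : ι → X} {ρ : ℝ} {hρ : 0 < ρ} {ε : ℝ}

section Regular

variable [TopologicalSpace X]

/-- The confined domain among round scatterers is closed (regular geometry at `ε` and `ρ`). [folklore] -/
theorem isClosed_confinedDomain (hG : G.IsHardSphereRegular ε) (hGρ : G.IsHardSphereRegular ρ) :
    IsClosed (confinedDomain G (Wall.balls G ctr ρ hρ) N ε) := by
  have h : confinedDomain G (Wall.balls G ctr ρ hρ) N ε =
      hardSphereDomain G N ε ∩ ⋂ i : Fin N, ⋂ k : ι, {z | ρ ≤ ‖G.sepVec (z i).1 (ctr k)‖} := by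
    ext z
    simp [mem_confinedDomain_balls_iff]
  rw [h]
  exact hG.isClosed_hardSphereDomain.inter (isClosed_iInter fun i => isClosed_iInter fun k =>
    isClosed_le continuous_const (hGρ.continuous_norm_sepVec_config_point i (ctr k)))

/-- **No incoming contact of either kind ⇒ the free flight stays confined for a while.** If `z`
is confined, none of its contact pairs is incoming and none of its sphere–scatterer contacts is
wall-incoming, then `S_t z` is confined for all small `t ≥ 0`. [folklore] -/
theorem eventually_freeFlight_mem_confinedDomain [Finite ι] (hG : G.IsHardSphereRegular ε)
    (hGρ : G.IsHardSphereRegular ρ) {z : Config N d X}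
    (hz : z ∈ confinedDomain G (Wall.balls G ctr ρ hρ) N ε)
    (h : ∀ i j : Fin N, i ≠ j → z ∈ contactSet G N ε i j → ¬IsIncoming G z i j)
    (hw : ∀ (i : Fin N) (k : ι), (z i).1 ∈ (Wall.balls G ctr ρ hρ k).contact →
      ¬IsWallIncoming (Wall.balls G ctr ρ hρ k) z i) :
    ∀ᶠ t : ℝ in 𝓝[≥] 0, freeFlight G t z ∈ confinedDomain G (Wall.balls G ctr ρ hρ) N ε := by
  have hpairs := hG.eventually_freeFlight_mem hz.1 h
  have hwall : ∀ q : Fin N × ι, ∀ᶠ t : ℝ in 𝓝[≥] 0,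
      ρ ≤ ‖G.sepVec (freeFlight G t z q.1).1 (ctr q.2)‖ := by
    rintro ⟨i, k⟩
    have hle : ρ ≤ ‖G.sepVec (z i).1 (ctr k)‖ := hz.2 i k
    rcases hle.eq_or_lt with hc | hlt
    · have hnin : 0 ≤ ⟪G.sepVec (z i).1 (ctr k), (z i).2⟫_ℝ := by
        have := hw i k (Wall.mem_balls_contact_iff.2 hc.symm)
        rw [Wall.isWallIncoming_balls_iff, not_lt] at this
        exact this
      exact hGρ.eventually_le_norm_sepVec_freeFlight_point_of_nonneg_inner hc.symm hnin
    · exact ((hGρ.eventually_lt_norm_sepVec_freeFlight_point_of_lt hlt).filter_mono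
        nhdsWithin_le_nhds).mono fun t ht => le_of_lt ht
  haveI : Finite (Fin N × ι) := inferInstance
  filter_upwards [hpairs, eventually_all.2 hwall] with t ht htw
  exact ⟨ht, fun i k => htw (i, k)⟩

/-- **A wall-incoming contact ⇒ the free flight leaves the confined domain immediately.** [folklore] -/
theorem eventually_freeFlight_not_mem_confinedDomain_of_isWallIncoming (hGρ : G.IsHardSphereRegular ρ)
    {z : Config N d X} {i : Fin N} {k : ι} (hc : (z i).1 ∈ (Wall.balls G ctr ρ hρ k).contact)
    (hin : IsWallIncoming (Wall.balls G ctr ρ hρ k) z i) :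
    ∀ᶠ t : ℝ in 𝓝[>] 0, freeFlight G t z ∉ confinedDomain G (Wall.balls G ctr ρ hρ) N ε := by
  rw [Wall.isWallIncoming_balls_iff] at hin
  filter_upwards [hGρ.eventually_norm_sepVec_freeFlight_point_lt_of_neg_inner
    (Wall.mem_balls_contact_iff.1 hc) hin] with t ht hmem
  exact (not_le.2 ht) (hmem.2 i k)

/-- **An incoming contact pair ⇒ the free flight leaves the confined domain immediately.** [folklore] -/
theorem eventually_freeFlight_not_mem_confinedDomain_of_isIncoming (hG : G.IsHardSphereRegular ε)
    {W : ι → Wall d X} {z : Config N d X} {i j : Fin N} (hij : i ≠ j)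
    (hc : z ∈ contactSet G N ε i j) (hin : IsIncoming G z i j) :
    ∀ᶠ t : ℝ in 𝓝[>] 0, freeFlight G t z ∉ confinedDomain G W N ε := by
  filter_upwards [hG.eventually_freeFlight_not_mem hij hc hin] with t ht hmem
  exact ht hmem.1

end Regular

/-! ## Exit times: elementary bounds and the regular case -/

section ExitTime

variable {W : ι → Wall d X}

/-- If the free flight is outside the confined domain at times arbitrarily close to `r ≥ 0` from
the right, the exit time is at most `r`. [folklore] -/
theorem exitTime_le_of_frequently {z : Config N d X} {r : ℝ} (hr : 0 ≤ r)
    (h : ∃ᶠ t in 𝓝[>] r, freeFlight G t z ∉ confinedDomain G W N ε) :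
    exitTime G W ε z ≤ ENNReal.ofReal r := by
  by_contra hlt
  rw [not_le, ENNReal.lt_iff_exists_add_pos_lt] at hlt
  obtain ⟨δ, hδ, hδlt⟩ := hlt
  have hev : ∀ᶠ t in 𝓝[>] r, t ∈ Ioo r (r + δ) := Ioo_mem_nhdsGT (by simpa using hδ)
  obtain ⟨t, ht, htI⟩ := (h.and_eventually hev).exists
  refine ht (freeFlight_mem_confinedDomain_of_lt (hr.trans htI.1.le) (lt_of_le_of_lt ?_ hδlt))
  calc ENNReal.ofReal t = ENNReal.ofReal (r + (t - r)) := by rw [add_sub_cancel]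
    _ ≤ ENNReal.ofReal r + ENNReal.ofReal (t - r) := ENNReal.ofReal_add_le
    _ ≤ ENNReal.ofReal r + δ := by
        gcongr
        rw [← ENNReal.ofReal_coe_nnreal]
        exact ENNReal.ofReal_le_ofReal (by linarith [htI.2])

variable [TopologicalSpace X]

/-- **An incoming contact pair forces an immediate exit**: `τ(z) = 0`. [folklore] -/
theorem exitTime_eq_zero_of_isIncoming (hG : G.IsHardSphereRegular ε) {z : Config N d X}
    {i j : Fin N} (hij : i ≠ j) (hc : z ∈ contactSet G N ε i j) (hin : IsIncoming G z i j) :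
    exitTime G W ε z = 0 := by
  have h := exitTime_le_of_frequently (G := G) (W := W) (ε := ε) le_rfl
    (eventually_freeFlight_not_mem_confinedDomain_of_isIncoming hG hij hc hin).frequently
  rwa [ENNReal.ofReal_zero, nonpos_iff_eq_zero] at h

/-- **A wall-incoming contact forces an immediate exit**: `τ(z) = 0` (round scatterers). [folklore] -/
theorem exitTime_eq_zero_of_isWallIncoming (hGρ : G.IsHardSphereRegular ρ) {z : Config N d X}
    {i : Fin N} {k : ι} (hc : (z i).1 ∈ (Wall.balls G ctr ρ hρ k).contact)
    (hin : IsWallIncoming (Wall.balls G ctr ρ hρ k) z i) :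
    exitTime G (Wall.balls G ctr ρ hρ) ε z = 0 := by
  have h := exitTime_le_of_frequently (G := G) (W := Wall.balls G ctr ρ hρ) (ε := ε) le_rfl
    (eventually_freeFlight_not_mem_confinedDomain_of_isWallIncoming hGρ hc hin).frequently
  rwa [ENNReal.ofReal_zero, nonpos_iff_eq_zero] at h

/-- **No incoming contact of either kind gives a positive exit time** (round scatterers, regular
geometry at `ε` and `ρ`). [folklore] -/
theorem exitTime_pos [Finite ι] (hG : G.IsHardSphereRegular ε) (hGρ : G.IsHardSphereRegular ρ)
    {z : Config N d X} (hz : z ∈ confinedDomain G (Wall.balls G ctr ρ hρ) N ε)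
    (h : ∀ i j : Fin N, i ≠ j → z ∈ contactSet G N ε i j → ¬IsIncoming G z i j)
    (hw : ∀ (i : Fin N) (k : ι), (z i).1 ∈ (Wall.balls G ctr ρ hρ k).contact →
      ¬IsWallIncoming (Wall.balls G ctr ρ hρ k) z i) :
    0 < exitTime G (Wall.balls G ctr ρ hρ) ε z := by
  obtain ⟨δ, hδ, hmem⟩ : ∃ δ : ℝ, 0 < δ ∧ ∀ t : ℝ, 0 ≤ t → t < δ →
      freeFlight G t z ∈ confinedDomain G (Wall.balls G ctr ρ hρ) N ε := by
    have hev := eventually_freeFlight_mem_confinedDomain hG hGρ hz h hw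
    obtain ⟨u, hu, hsub⟩ := mem_nhdsGE_iff_exists_Ico_subset.1 hev
    exact ⟨u, hu, fun t ht htu => hsub ⟨ht, htu⟩⟩
  refine lt_of_lt_of_le (ENNReal.ofReal_pos.2 hδ) (le_exitTime_of_forall_mem fun t ht htδ => ?_)
  exact hmem t ht ((ENNReal.ofReal_lt_ofReal_iff hδ).1 htδ)

/-- **The exit configuration is confined**: if `z` is confined and `τ(z) < ∞` then `S_{τ(z)} z`
is confined (the confined domain is closed). [folklore] -/
theorem freeFlight_exitTime_mem (hG : G.IsHardSphereRegular ε) (hGρ : G.IsHardSphereRegular ρ)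
    {z : Config N d X} (hz : z ∈ confinedDomain G (Wall.balls G ctr ρ hρ) N ε)
    (hτ : exitTime G (Wall.balls G ctr ρ hρ) ε z ≠ ∞) :
    freeFlight G (exitTime G (Wall.balls G ctr ρ hρ) ε z).toReal z ∈
      confinedDomain G (Wall.balls G ctr ρ hρ) N ε := by
  set W := Wall.balls G ctr ρ hρ
  rcases (ENNReal.toReal_nonneg : 0 ≤ (exitTime G W ε z).toReal).eq_or_lt with h0 | h0
  · rw [← h0, freeFlight_zero]; exact hz
  have hc : Continuous fun t : ℝ => freeFlight G t z := hG.continuous_freeFlight z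
  refine (isClosed_confinedDomain hG hGρ).mem_of_tendsto
    ((hc.tendsto _).mono_left (nhdsWithin_le_nhds (s := Iio (exitTime G W ε z).toReal))) ?_
  filter_upwards [Ioo_mem_nhdsLT h0] with t ht
  refine freeFlight_mem_confinedDomain_of_lt ht.1.le ?_
  calc ENNReal.ofReal t < ENNReal.ofReal (exitTime G W ε z).toReal :=
        (ENNReal.ofReal_lt_ofReal_iff h0).2 ht.2
    _ = exitTime G W ε z := ENNReal.ofReal_toReal hτ

/-- **The exit configuration carries an incoming event**: if `z` is confined and `τ(z) < ∞`,
then in `S_{τ(z)} z` some pair is in contact with incoming velocities, or some sphere touches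
some scatterer with wall-incoming velocity (otherwise the free flight would stay confined a
while longer). [folklore] -/
theorem exists_event_freeFlight_exitTime [Finite ι] (hG : G.IsHardSphereRegular ε)
    (hGρ : G.IsHardSphereRegular ρ) {z : Config N d X}
    (hz : z ∈ confinedDomain G (Wall.balls G ctr ρ hρ) N ε)
    (hτ : exitTime G (Wall.balls G ctr ρ hρ) ε z ≠ ∞) :
    (∃ i j : Fin N, i ≠ j ∧
        freeFlight G (exitTime G (Wall.balls G ctr ρ hρ) ε z).toReal z ∈ contactSet G N ε i j ∧
        IsIncoming G (freeFlight G (exitTime G (Wall.balls G ctr ρ hρ) ε z).toReal z) i j) ∨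
      ∃ (i : Fin N) (k : ι),
        (freeFlight G (exitTime G (Wall.balls G ctr ρ hρ) ε z).toReal z i).1 ∈
            (Wall.balls G ctr ρ hρ k).contact ∧
          IsWallIncoming (Wall.balls G ctr ρ hρ k)
            (freeFlight G (exitTime G (Wall.balls G ctr ρ hρ) ε z).toReal z) i := by
  set W := Wall.balls G ctr ρ hρ with hW
  by_contra hno
  push Not at hno
  set r := (exitTime G W ε z).toReal with hr
  have hw := freeFlight_exitTime_mem hG hGρ hz hτ
  have hpos := exitTime_pos hG hGρ hw (fun i j hij hc hin => hno.1 i j hij hc hin)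
    (fun i k hc hin => hno.2 i k hc hin)
  have hle : ENNReal.ofReal r + exitTime G W ε (freeFlight G r z) ≤ exitTime G W ε z := by
    refine le_exitTime_of_forall_mem fun t ht htc => ?_
    rcases lt_or_ge t r with htr | hrt
    · refine freeFlight_mem_confinedDomain_of_lt ht ?_
      calc ENNReal.ofReal t < ENNReal.ofReal r := (ENNReal.ofReal_lt_ofReal_iff (ht.trans_lt htr)).2 htr
        _ = exitTime G W ε z := ENNReal.ofReal_toReal hτ
    · have hsplit : freeFlight G t z = freeFlight G (t - r) (freeFlight G r z) := by
        rw [← freeFlight_add, sub_add_cancel]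
      rw [hsplit]
      refine freeFlight_mem_confinedDomain_of_lt (sub_nonneg.2 hrt) ?_
      have ht' : ENNReal.ofReal t = ENNReal.ofReal r + ENNReal.ofReal (t - r) := by
        rw [← ENNReal.ofReal_add ENNReal.toReal_nonneg (sub_nonneg.2 hrt), add_sub_cancel]
      rw [ht', ENNReal.add_lt_add_iff_left ENNReal.ofReal_ne_top] at htc
      exact htc
  have hlt : ENNReal.ofReal r < ENNReal.ofReal r + exitTime G W ε (freeFlight G r z) :=
    ENNReal.lt_add_right ENNReal.ofReal_ne_top hpos.ne'
  rw [hr, ENNReal.ofReal_toReal hτ] at hle hlt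
  exact (lt_irrefl _) (hlt.trans_le hle)

end ExitTime

/-! ## Simple events with the event named -/

section Simple

/-- `z` is a simple pair-event configuration *with colliding pair `p = (i, j)`, `i < j`*: a
simple incoming collision configuration of the wall-free theory with that pair
(`Alexander.IsSimpleIncomingWith`) and no sphere on a wall. [folklore] -/
def IsSimplePairEventWith (G₀ : Geometry d X) (W : ι → Wall d X) (ε₀ : ℝ) (z : Config N d X)
    (p : Fin N × Fin N) : Prop :=
  Alexander.IsSimpleIncomingWith G₀ ε₀ z p ∧ ∀ (i : Fin N) (k : ι), (z i).1 ∉ (W k).contact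

/-- `z` is a simple wall-event configuration *with contact `q = (i, k)`*: sphere `i` touches wall
`k` with wall-incoming velocity, this is the only sphere–wall contact, and no pair is in contact. [folklore] -/
def IsSimpleWallEventWith (G₀ : Geometry d X) (W : ι → Wall d X) (ε₀ : ℝ) (z : Config N d X)
    (q : Fin N × ι) : Prop :=
  (z q.1).1 ∈ (W q.2).contact ∧ IsWallIncoming (W q.2) z q.1 ∧
    (∀ (i : Fin N) (k : ι), (z i).1 ∈ (W k).contact → i = q.1 ∧ k = q.2) ∧
    ∀ i j : Fin N, i ≠ j → z ∉ contactSet G₀ N ε₀ i j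

variable {W : ι → Wall d X}

/-- `IsSimplePairEvent` is `IsSimplePairEventWith` for some pair. [folklore] -/
theorem isSimplePairEvent_iff_exists {z : Config N d X} :
    IsSimplePairEvent G W ε z ↔ ∃ p, IsSimplePairEventWith G W ε z p := by
  simp only [IsSimplePairEvent, Alexander.isSimpleIncoming_iff, IsSimplePairEventWith]
  exact ⟨fun ⟨⟨p, hp⟩, hw⟩ => ⟨p, hp, hw⟩, fun ⟨p, hp, hw⟩ => ⟨⟨p, hp⟩, hw⟩⟩

/-- `IsSimpleWallEvent` is `IsSimpleWallEventWith` for some contact. [folklore] -/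
theorem isSimpleWallEvent_iff_exists {z : Config N d X} :
    IsSimpleWallEvent G W ε z ↔ ∃ q, IsSimpleWallEventWith G W ε z q :=
  Iff.rfl

namespace IsSimplePairEventWith

variable {z : Config N d X} {p : Fin N × Fin N}

/-- The underlying simple incoming collision configuration. [folklore] -/
theorem isSimpleIncomingWith (hp : IsSimplePairEventWith G W ε z p) :
    Alexander.IsSimpleIncomingWith G ε z p := hp.1

/-- No sphere touches a wall. [folklore] -/
theorem not_mem_contact (hp : IsSimplePairEventWith G W ε z p) (i : Fin N) (k : ι) :
    (z i).1 ∉ (W k).contact := hp.2 i k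

/-- The unnamed version. [folklore] -/
theorem isSimplePairEvent (hp : IsSimplePairEventWith G W ε z p) : IsSimplePairEvent G W ε z :=
  isSimplePairEvent_iff_exists.2 ⟨p, hp⟩

/-- There is no incoming wall contact. [folklore] -/
theorem incomingWalls_eq_empty (hp : IsSimplePairEventWith G W ε z p) : incomingWalls W z = ∅ :=
  hp.isSimplePairEvent.incomingWalls_eq_empty

/-- **The event resolution at a simple pair event is the elastic collision of its pair** (no
choice is involved: `incomingPairs = {p}`). [folklore] -/
theorem eventJump_eq (hp : IsSimplePairEventWith G W ε z p) :
    eventJump G W ε z = collidePair G p.1 p.2 z := by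
  have hne : (Alexander.incomingPairs G ε z).Nonempty := ⟨p, by rw [hp.1.incomingPairs_eq]; rfl⟩
  have hsome : hne.some = p := hp.1.incomingPairs_eq.subset hne.some_mem
  rw [eventJump_of_incomingPairs_nonempty hne, hsome]

/-- Transport to a configuration with the same positions in which the pair is still incoming. [folklore] -/
theorem of_fst_eq (hp : IsSimplePairEventWith G W ε z p) {c : Config N d X}
    (hcz : ∀ k, (c k).1 = (z k).1) (hin : IsIncoming G c p.1 p.2) :
    IsSimplePairEventWith G W ε c p :=
  ⟨hp.1.of_fst_eq hcz hin, fun i k => by rw [hcz]; exact hp.2 i k⟩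

/-- A simple pair event configuration that is wall-admissible is confined. [folklore] -/
theorem mem_confinedDomain (hp : IsSimplePairEventWith G W ε z p)
    (hreg : ∀ (i : Fin N) (k : ι), (z i).1 ∈ (W k).region) : z ∈ confinedDomain G W N ε :=
  ⟨hp.1.mem_hardSphereDomain, hreg⟩

/-- **After a simple pair event the exit time is positive** (round scatterers, regular geometry):
the post-collisional configuration has only outgoing contact pairs and no wall contact. [folklore] -/
theorem exitTime_collidePair_pos [TopologicalSpace X] [Finite ι] (hG : G.IsHardSphereRegular ε)
    (hGρ : G.IsHardSphereRegular ρ) {z : Config N d X} {p : Fin N × Fin N}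
    (hp : IsSimplePairEventWith G (Wall.balls G ctr ρ hρ) ε z p)
    (hz : z ∈ confinedDomain G (Wall.balls G ctr ρ hρ) N ε) :
    0 < exitTime G (Wall.balls G ctr ρ hρ) ε (collidePair G p.1 p.2 z) := by
  refine exitTime_pos hG hGρ ?_ (fun i j hij hc hin => ?_) (fun i k hc _ => ?_)
  · exact ⟨(collidePair_mem_hardSphereDomain_iff z).2 hz.1, fun i k => by
      rw [collidePair_apply_fst]; exact hz.2 i k⟩
  · have hc' : z ∈ contactSet G N ε i j :=
      (mem_contactSet_congr_fst fun k => collidePair_apply_fst z k).1 hc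
    exact lt_asymm hin (hp.1.isOutgoing_collidePair hG hij hc')
  · rw [collidePair_apply_fst] at hc
    exact hp.2 i k hc

end IsSimplePairEventWith

namespace IsSimpleWallEventWith

variable {z : Config N d X} {q : Fin N × ι}

/-- The sphere touches the wall. [folklore] -/
theorem mem_contact (hq : IsSimpleWallEventWith G W ε z q) : (z q.1).1 ∈ (W q.2).contact := hq.1

/-- The contact is wall-incoming. [folklore] -/
theorem isWallIncoming (hq : IsSimpleWallEventWith G W ε z q) : IsWallIncoming (W q.2) z q.1 :=
  hq.2.1

/-- Any sphere–wall contact is the named one. [folklore] -/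
theorem eq_of_mem_contact (hq : IsSimpleWallEventWith G W ε z q) {i : Fin N} {k : ι}
    (hc : (z i).1 ∈ (W k).contact) : i = q.1 ∧ k = q.2 :=
  hq.2.2.1 i k hc

/-- No pair is in contact. [folklore] -/
theorem not_mem_contactSet (hq : IsSimpleWallEventWith G W ε z q) {i j : Fin N} (hij : i ≠ j) :
    z ∉ contactSet G N ε i j :=
  hq.2.2.2 i j hij

/-- The unnamed version. [folklore] -/
theorem isSimpleWallEvent (hq : IsSimpleWallEventWith G W ε z q) : IsSimpleWallEvent G W ε z :=
  ⟨q, hq⟩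

/-- There is no incoming contact pair. [folklore] -/
theorem incomingPairs_eq_empty (hq : IsSimpleWallEventWith G W ε z q) :
    Alexander.incomingPairs G ε z = ∅ :=
  hq.isSimpleWallEvent.incomingPairs_eq_empty

/-- The incoming wall contacts are exactly the named one. [folklore] -/
theorem incomingWalls_eq (hq : IsSimpleWallEventWith G W ε z q) : incomingWalls W z = {q} := by
  ext q'
  simp only [mem_incomingWalls, mem_singleton_iff]
  constructor
  · rintro ⟨hc, -⟩
    obtain ⟨h1, h2⟩ := hq.eq_of_mem_contact hc
    exact Prod.ext h1 h2
  · rintro rfl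
    exact ⟨hq.mem_contact, hq.isWallIncoming⟩

/-- **The event resolution at a simple wall event is the specular reflection of its sphere at its
wall** (no choice is involved: `incomingPairs = ∅`, `incomingWalls = {q}`). [folklore] -/
theorem eventJump_eq (hq : IsSimpleWallEventWith G W ε z q) :
    eventJump G W ε z = reflectWall (W q.2) q.1 z := by
  have hne : (incomingWalls W z).Nonempty := ⟨q, by rw [hq.incomingWalls_eq]; rfl⟩
  have hsome : hne.some = q := hq.incomingWalls_eq.subset hne.some_mem
  have hno : ¬(Alexander.incomingPairs G ε z).Nonempty := by
    rw [hq.incomingPairs_eq_empty]; exact Set.not_nonempty_empty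
  rw [eventJump_of_incomingWalls_nonempty hno hne, hsome]

/-- Transport to a configuration with the same positions in which the contact is still
wall-incoming. [folklore] -/
theorem of_fst_eq (hq : IsSimpleWallEventWith G W ε z q) {c : Config N d X}
    (hcz : ∀ k, (c k).1 = (z k).1) (hin : IsWallIncoming (W q.2) c q.1) :
    IsSimpleWallEventWith G W ε c q := by
  refine ⟨by rw [hcz]; exact hq.mem_contact, hin, fun i k hc => ?_, fun i j hij hc => ?_⟩
  · rw [hcz] at hc
    exact hq.eq_of_mem_contact hc
  · exact hq.not_mem_contactSet hij ((mem_contactSet_congr_fst hcz).1 hc)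

/-- After the reflection the named contact is wall-outgoing. [folklore] -/
theorem isWallOutgoing_reflectWall (hq : IsSimpleWallEventWith G W ε z q) :
    IsWallOutgoing (W q.2) (reflectWall (W q.2) q.1 z) q.1 :=
  (isWallOutgoing_reflectWall_iff (W q.2) q.1 z).2 hq.isWallIncoming

/-- After the reflection every sphere–wall contact is wall-outgoing. [folklore] -/
theorem isWallOutgoing_reflectWall_of_mem_contact (hq : IsSimpleWallEventWith G W ε z q)
    {i : Fin N} {k : ι} (hc : (z i).1 ∈ (W k).contact) :
    IsWallOutgoing (W k) (reflectWall (W q.2) q.1 z) i := by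
  obtain ⟨rfl, rfl⟩ := hq.eq_of_mem_contact hc
  exact hq.isWallOutgoing_reflectWall

/-- **After a simple wall event the exit time is positive** (round scatterers, regular geometry):
the reflected configuration has no pair contact and its only wall contact is outgoing. [folklore] -/
theorem exitTime_reflectWall_pos [TopologicalSpace X] [Finite ι] (hG : G.IsHardSphereRegular ε)
    (hGρ : G.IsHardSphereRegular ρ) {z : Config N d X} {q : Fin N × ι}
    (hq : IsSimpleWallEventWith G (Wall.balls G ctr ρ hρ) ε z q)
    (hz : z ∈ confinedDomain G (Wall.balls G ctr ρ hρ) N ε) :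
    0 < exitTime G (Wall.balls G ctr ρ hρ) ε (reflectWall (Wall.balls G ctr ρ hρ q.2) q.1 z) := by
  refine exitTime_pos hG hGρ ((reflectWall_mem_confinedDomain_iff _ _ z).2 hz)
    (fun i j hij hc _ => ?_) (fun i k hc hin => ?_)
  · exact hq.not_mem_contactSet hij (reflectWall_mem_contactSet_iff.1 hc)
  · rw [reflectWall_apply_fst] at hc
    have hout := hq.isWallOutgoing_reflectWall_of_mem_contact hc
    exact lt_asymm hin hout

end IsSimpleWallEventWith

/-- A simple pair event configuration is not a simple wall event configuration. [folklore] -/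
theorem IsSimplePairEventWith.not_isSimpleWallEvent {z : Config N d X} {p : Fin N × Fin N}
    (hp : IsSimplePairEventWith G W ε z p) : ¬IsSimpleWallEvent G W ε z := fun ⟨q, hq⟩ =>
  hp.not_mem_contact q.1 q.2 hq.1

/-- At a simple event configuration, the event resolution does not depend on anything but the
event: it is `collidePair` of the pair or `reflectWall` of the contact. [folklore] -/
theorem IsSimpleEvent.exists_eventJump_eq {z : Config N d X} (h : IsSimpleEvent G W ε z) :
    (∃ p, IsSimplePairEventWith G W ε z p ∧ eventJump G W ε z = collidePair G p.1 p.2 z) ∨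
      ∃ q, IsSimpleWallEventWith G W ε z q ∧ eventJump G W ε z = reflectWall (W q.2) q.1 z := by
  rcases h with h | h
  · obtain ⟨p, hp⟩ := isSimplePairEvent_iff_exists.1 h
    exact Or.inl ⟨p, hp, hp.eventJump_eq⟩
  · obtain ⟨q, hq⟩ := isSimpleWallEvent_iff_exists.1 h
    exact Or.inr ⟨q, hq, hq.eventJump_eq⟩

/-- **The event step at a simple pair exit configuration** is the elastic collision of its pair. [folklore] -/
theorem eventStep_eq_collidePair {z : Config N d X} (hτ : exitTime G W ε z ≠ ∞) {p : Fin N × Fin N}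
    (hp : IsSimplePairEventWith G W ε (freeFlight G (exitTime G W ε z).toReal z) p) :
    eventStep G W ε z = collidePair G p.1 p.2 (freeFlight G (exitTime G W ε z).toReal z) := by
  rw [eventStep_of_ne_top hτ, hp.eventJump_eq]

/-- **The event step at a simple wall exit configuration** is the specular reflection of its
sphere at its wall. [folklore] -/
theorem eventStep_eq_reflectWall {z : Config N d X} (hτ : exitTime G W ε z ≠ ∞) {q : Fin N × ι}
    (hq : IsSimpleWallEventWith G W ε (freeFlight G (exitTime G W ε z).toReal z) q) :
    eventStep G W ε z = reflectWall (W q.2) q.1 (freeFlight G (exitTime G W ε z).toReal z) := by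
  rw [eventStep_of_ne_top hτ, hq.eventJump_eq]

/-- **After a simple event the exit time is positive** (round scatterers, regular geometry). [folklore] -/
theorem IsSimpleEvent.exitTime_eventJump_pos [TopologicalSpace X] [Finite ι]
    (hG : G.IsHardSphereRegular ε) (hGρ : G.IsHardSphereRegular ρ) {z : Config N d X}
    (h : IsSimpleEvent G (Wall.balls G ctr ρ hρ) ε z)
    (hz : z ∈ confinedDomain G (Wall.balls G ctr ρ hρ) N ε) :
    0 < exitTime G (Wall.balls G ctr ρ hρ) ε (eventJump G (Wall.balls G ctr ρ hρ) ε z) := by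
  rcases h.exists_eventJump_eq with ⟨p, hp, heq⟩ | ⟨q, hq, heq⟩
  · rw [heq]; exact hp.exitTime_collidePair_pos hG hGρ hz
  · rw [heq]; exact hq.exitTime_reflectWall_pos hG hGρ hz

/-- After a simple event no contact pair is incoming (regular geometry). [folklore] -/
theorem IsSimpleEvent.not_isIncoming_eventJump [TopologicalSpace X] (hG : G.IsHardSphereRegular ε)
    {z : Config N d X} (h : IsSimpleEvent G W ε z) {i j : Fin N} (hij : i ≠ j)
    (hc : z ∈ contactSet G N ε i j) : IsOutgoing G (eventJump G W ε z) i j := by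
  rcases h.exists_eventJump_eq with ⟨p, hp, heq⟩ | ⟨q, hq, -⟩
  · rw [heq]; exact hp.1.isOutgoing_collidePair hG hij hc
  · exact (hq.not_mem_contactSet hij hc).elim

/-- After a simple event every sphere–wall contact is wall-outgoing. [folklore] -/
theorem IsSimpleEvent.isWallOutgoing_eventJump {z : Config N d X} (h : IsSimpleEvent G W ε z)
    {i : Fin N} {k : ι} (hc : (z i).1 ∈ (W k).contact) :
    IsWallOutgoing (W k) (eventJump G W ε z) i := by
  rcases h.exists_eventJump_eq with ⟨p, hp, -⟩ | ⟨q, hq, heq⟩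
  · exact (hp.not_mem_contact i k hc).elim
  · rw [heq]; exact hq.isWallOutgoing_reflectWall_of_mem_contact hc

end Simple

end ConfinedAlexander

end Kinetic

end

end Literature.Analysis.FluidPDE
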